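import Summits.Langlands.Langlands.Theorems.SoloBlindWDClass
import Literature.NumberTheory.GaloisRepresentations.WeilDeligneOfGaloisProofs
import Mathlib.Algebra.Ring.Action.ConjAct
import HarnessLib

/-!
# Weil–Deligne bookkeeping (WD-A): the Grothendieck–Deligne relation is conjugation covariant

Discharges hypothesis (WD-A) of `SoloBlind.recGL_eq_of_globalLanglands`
(`SoloBlindLocalAgreement`): if `r` is attached to `ρW : W_F → GL_n(E)` by the Grothendieck–Deligne
recipe `IsWeilDeligneOfLadic` and `r'` is attached to the conjugate `g ρW g⁻¹`, then `r ≅ r'`.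
Proof: the transport `r^g = (g ρ g⁻¹, g N g⁻¹)` of `r` is attached to `g ρW g⁻¹` with the SAME tame
character `t`, open subgroup `U` and Frobenius `Φ` (conjugating the two defining identities, using
`exp(g A g⁻¹) = g exp(A) g⁻¹` for nilpotent `A`); then `r ≅ r^g` tautologically and `r^g ≅ r'` by
independence of choices (tree: `IsWeilDeligneOfLadic.isEquivalent_holds`, Deligne 1973 §8.4.2).

## References

* P. Deligne, *Les constantes des équations fonctionnelles des fonctions L*, Antwerp II, LNM 349
  (1973), §8.4.2. [DeligneAntwerpII1973]
* J. Tate, *Number theoretic background*, Corvallis 1979, (4.2.1). [TateCorvallis1979]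
-/

open Module Matrix

noncomputable section

namespace Summit.Langlands.Langlands.Theorems

namespace SoloBlind

open Literature.NumberTheory.GaloisRepresentations

variable {F : Type*} [Field F] [ValuativeRel F] [TopologicalSpace F] [IsNonarchimedeanLocalField F]
variable {E : Type*} [Field E] [CharZero E] {n : ℕ}

/-- `exp` of nilpotent matrices commutes with conjugation by an invertible matrix. [folklore] -/
theorem exp_units_conj (g : GL (Fin n) E) {A : Matrix (Fin n) (Fin n) E} (hA : IsNilpotent A) :
    IsNilpotent.exp ((g : Matrix (Fin n) (Fin n) E) * A * ((g⁻¹ : GL (Fin n) E) : Matrix (Fin n) (Fin n) E)) =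
      (g : Matrix (Fin n) (Fin n) E) * IsNilpotent.exp A * ((g⁻¹ : GL (Fin n) E) : Matrix (Fin n) (Fin n) E) := by
  have h := IsNilpotent.exp_smul (ConjAct.toConjAct g) hA
  simpa [ConjAct.units_smul_def] using h

omit [CharZero E] in
/-- The linear automorphism of `Eⁿ` given by an invertible matrix (standard basis). [folklore] -/
theorem exists_linearEquiv_of_units (g : GL (Fin n) E) :
    ∃ e : (Fin n → E) ≃ₗ[E] (Fin n → E),
      LinearMap.toMatrix' (e : (Fin n → E) →ₗ[E] (Fin n → E)) = (g : Matrix (Fin n) (Fin n) E) ∧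
      LinearMap.toMatrix' (e.symm : (Fin n → E) →ₗ[E] (Fin n → E)) =
        ((g⁻¹ : GL (Fin n) E) : Matrix (Fin n) (Fin n) E) := by
  refine ⟨LinearEquiv.ofLinear (Matrix.toLin' (g : Matrix (Fin n) (Fin n) E))
      (Matrix.toLin' ((g⁻¹ : GL (Fin n) E) : Matrix (Fin n) (Fin n) E))
      (by rw [← Matrix.toLin'_mul, Units.mul_inv, Matrix.toLin'_one])
      (by rw [← Matrix.toLin'_mul, Units.inv_mul, Matrix.toLin'_one]), ?_, ?_⟩
  · exact LinearMap.toMatrix'_toLin' _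
  · exact LinearMap.toMatrix'_toLin' _

omit [CharZero E] in
/-- Matrix of a conjugated endomorphism. [folklore] -/
theorem toMatrix'_conjAlgEquiv {e : (Fin n → E) ≃ₗ[E] (Fin n → E)} {g : GL (Fin n) E}
    (he : LinearMap.toMatrix' (e : (Fin n → E) →ₗ[E] (Fin n → E)) = (g : Matrix (Fin n) (Fin n) E))
    (he' : LinearMap.toMatrix' (e.symm : (Fin n → E) →ₗ[E] (Fin n → E)) =
      ((g⁻¹ : GL (Fin n) E) : Matrix (Fin n) (Fin n) E))
    (f : Module.End E (Fin n → E)) :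
    LinearMap.toMatrix' (e.conjAlgEquiv E f) =
      (g : Matrix (Fin n) (Fin n) E) * LinearMap.toMatrix' f * ((g⁻¹ : GL (Fin n) E) : Matrix (Fin n) (Fin n) E) := by
  rw [LinearEquiv.conjAlgEquiv_apply, LinearMap.toMatrix'_comp, LinearMap.toMatrix'_comp, he, he',
    mul_assoc]

/-- **The transport `(g ρ g⁻¹, g N g⁻¹)` of a Weil–Deligne representation attached to `ρW` is
attached to `g ρW g⁻¹`** (same `t`, `U`, `Φ`). [cite: DeligneAntwerpII1973, §8.4.2] -/
theorem isWeilDeligneOfLadic_conj_transport {ρW : WeilGroup F →* GL (Fin n) E} {g : GL (Fin n) E}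
    {r r' : WeilDeligneRep F E (Fin n → E)} {e : (Fin n → E) ≃ₗ[E] (Fin n → E)}
    (he : LinearMap.toMatrix' (e : (Fin n → E) →ₗ[E] (Fin n → E)) = (g : Matrix (Fin n) (Fin n) E))
    (he' : LinearMap.toMatrix' (e.symm : (Fin n → E) →ₗ[E] (Fin n → E)) =
      ((g⁻¹ : GL (Fin n) E) : Matrix (Fin n) (Fin n) E))
    (hρ : ∀ w, r'.ρ w = e.conjAlgEquiv E (r.ρ w)) (hN : r'.N = e.conjAlgEquiv E r.N)
    (h : IsWeilDeligneOfLadic ρW r) :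
    IsWeilDeligneOfLadic ((MulAut.conj g).toMonoidHom.comp ρW) r' := by
  obtain ⟨t, U, Φ, hU, hUo, hΦ, hnt, h2, h3⟩ := h
  have hNmat : LinearMap.toMatrix' r'.N =
      (g : Matrix (Fin n) (Fin n) E) * LinearMap.toMatrix' r.N * ((g⁻¹ : GL (Fin n) E) : Matrix (Fin n) (Fin n) E) := by
    rw [hN, toMatrix'_conjAlgEquiv he he']
  have hNnil : IsNilpotent (LinearMap.toMatrix' r.N) := by
    obtain ⟨k, hk⟩ := r.isNilpotent_N.map LinearMap.toMatrixAlgEquiv'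
    exact ⟨k, hk⟩
  have hnil : ∀ c : E, IsNilpotent (c • LinearMap.toMatrix' r.N) := fun c ↦ hNnil.smul c
  have hconjW : ∀ w : WeilGroup F,
      ((((MulAut.conj g).toMonoidHom.comp ρW) w : GL (Fin n) E) : Matrix (Fin n) (Fin n) E) =
        (g : Matrix (Fin n) (Fin n) E) * ((ρW w : GL (Fin n) E) : Matrix (Fin n) (Fin n) E) *
          ((g⁻¹ : GL (Fin n) E) : Matrix (Fin n) (Fin n) E) := fun w ↦ by
    simp only [MonoidHom.coe_comp, MulEquiv.coe_toMonoidHom, Function.comp_apply, MulAut.conj_apply,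
      Units.val_mul]
  have hsmul : ∀ c : E, c • LinearMap.toMatrix' r'.N =
      (g : Matrix (Fin n) (Fin n) E) * (c • LinearMap.toMatrix' r.N) * ((g⁻¹ : GL (Fin n) E) : Matrix (Fin n) (Fin n) E) := fun c ↦ by
    rw [hNmat, Matrix.mul_smul, Matrix.smul_mul]
  refine ⟨t, U, Φ, hU, hUo, hΦ, hnt, fun u hu ↦ ?_, fun m u ↦ ?_⟩
  · rw [hconjW, h2 u hu, hsmul, exp_units_conj g (hnil _)]
  · rw [hρ, toMatrix'_conjAlgEquiv he he', h3 m u, hconjW, hsmul, ← neg_mul, ← mul_neg,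
      exp_units_conj g (hnil _).neg]
    simp only [mul_assoc, Units.inv_mul_cancel_left]

/-- **(WD-A) The Grothendieck–Deligne relation is conjugation covariant up to isomorphism**: a
Weil–Deligne representation attached to `ρW` and one attached to `g ρW g⁻¹` are isomorphic.
[cite: DeligneAntwerpII1973, §8.4.2] [cite: TateCorvallis1979, (4.2.1)] -/
theorem wd_isEquivalent_of_isWeilDeligneOfLadic_conj (ρW : WeilGroup F →* GL (Fin n) E)
    (g : GL (Fin n) E) (r r' : WeilDeligneRep F E (Fin n → E)) (h : IsWeilDeligneOfLadic ρW r)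
    (h' : IsWeilDeligneOfLadic ((MulAut.conj g).toMonoidHom.comp ρW) r') : r.IsEquivalent r' := by
  obtain ⟨e, he, he'⟩ := exists_linearEquiv_of_units (E := E) g
  obtain ⟨rg, hρ, hN⟩ := wd_exists_transport r e
  have hg : IsWeilDeligneOfLadic ((MulAut.conj g).toMonoidHom.comp ρW) rg :=
    isWeilDeligneOfLadic_conj_transport he he' hρ hN h
  exact (wd_isEquivalent_of_transport e hρ hN).trans
    (IsWeilDeligneOfLadic.isEquivalent_holds _ rg r' hg h')

end SoloBlind

end Summit.Langlands.Langlands.Theorems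

end
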